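import Mathlib
import Summits.ValiantsHypothesis.ValiantsHypothesis.Theorems.BarrierLeverPartitionMinorsHitByVPHiddenStatesFullJoinStep

/-!
# Route BarrierLever — item `PartitionMinorsHitByVP` (stmt-ValiantsHypothesis-19717), line `hidden_states`:
# GENERICITY OF THE FULL JOIN — two good tables give one common good table; the equal-link step from SEPARATE hypotheses

Helper file (`--supports stmt-ValiantsHypothesis-19717`; cell valiant-natproofs, rung V4, 𝒟-side door (c), line
`Cruxes/PartitionMinorsHitByVP/Lines/hidden_states.lean` v8; prover seat val-np-p3 gen 16). Definition-free. Closes NO item.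

THE POINT (memo val-np-p3 g16 «full join» §8(b)). The determinant of the `K`-state full hidden sum of a pair `(u, w)` is the evaluation of
ONE polynomial in the table/weight variables (`eval_fullJoinPoly_det`), so «some table is good» means «that polynomial is nonzero», and two
pairs that are good separately are good at a COMMON table (`exists_common_table`: the product of two nonzero polynomials over `ℂ` has a
non-root, `MvPolynomial.funext`). Consequently the equal-link step p675243 `fullJoinCube_step` holds from SEPARATE hypotheses on the
deletion pair and the link pair (`fullJoinCube_step'`) — the inductive step of the PEEL⁺ scheme: FJ(deletion pair, K) ∧ FJ(link pair, K)
⇒ FJ(pair, K + 1) whenever the two sides split with equal link sizes at some coordinates `a`, `b` (and `u`'s link rows have deletion partners).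

WHAT THIS IS NOT: no pair is certified here beyond the hypotheses; item 19717 stays OPEN; nothing on crux 14610 or VP ≠ VNP.
-/

set_option linter.dupNamespace false

namespace Summit.ValiantsHypothesis.ValiantsHypothesis.Theorems.BarrierLever.HiddenStates

open Finset Matrix

noncomputable section

namespace FullJoin

variable {h K : ℕ}

/-- The valuation of the table/weight variables `(Option (Fin K) × Fin h) ⊕ (Option (Fin K) × Fin h) ⊕ Fin K` determined by tables
`tx, ty` and weights `lam`. -/
theorem eval_fullJoinPoly_entry (tx ty : Option (Fin K) → Fin h → ℂ) (lam : Fin K → ℂ) (U W : Finset (Fin h)) :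
    MvPolynomial.eval (fun v : (Option (Fin K) × Fin h) ⊕ (Option (Fin K) × Fin h) ⊕ Fin K =>
        Sum.elim (fun p => tx p.1 p.2) (Sum.elim (fun p => ty p.1 p.2) lam) v)
      (∑ J : Finset (Fin K), (∏ q ∈ J, MvPolynomial.X (Sum.inr (Sum.inr q))) *
        ((∏ a ∈ U, (MvPolynomial.X (Sum.inl (none, a)) + ∑ q ∈ J, MvPolynomial.X (Sum.inl (some q, a)))) *
          ∏ c ∈ W, (MvPolynomial.X (Sum.inr (Sum.inl (none, c))) +
            ∑ q ∈ J, MvPolynomial.X (Sum.inr (Sum.inl (some q, c)))))) =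
      ∑ J : Finset (Fin K), (∏ q ∈ J, lam q) *
        ((∏ a ∈ U, (tx none a + ∑ q ∈ J, tx (some q) a)) * ∏ c ∈ W, (ty none c + ∑ q ∈ J, ty (some q) c)) := by
  simp only [map_sum, map_mul, map_prod, map_add, MvPolynomial.eval_X, Sum.elim_inl, Sum.elim_inr]

/-- **The determinant of the full hidden sum is a polynomial evaluation.** -/
theorem eval_fullJoinPoly_det {r : ℕ} (u w : Fin r → Finset (Fin h))
    (tx ty : Option (Fin K) → Fin h → ℂ) (lam : Fin K → ℂ) :
    MvPolynomial.eval (fun v : (Option (Fin K) × Fin h) ⊕ (Option (Fin K) × Fin h) ⊕ Fin K =>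
        Sum.elim (fun p => tx p.1 p.2) (Sum.elim (fun p => ty p.1 p.2) lam) v)
      (Matrix.of fun i j : Fin r => ∑ J : Finset (Fin K), (∏ q ∈ J, MvPolynomial.X (Sum.inr (Sum.inr q))) *
        ((∏ a ∈ u i, (MvPolynomial.X (Sum.inl (none, a)) + ∑ q ∈ J, MvPolynomial.X (Sum.inl (some q, a)))) *
          ∏ c ∈ w j, (MvPolynomial.X (Sum.inr (Sum.inl (none, c))) +
            ∑ q ∈ J, MvPolynomial.X (Sum.inr (Sum.inl (some q, c)))))).det =
      (Matrix.of fun i j : Fin r => ∑ J : Finset (Fin K), (∏ q ∈ J, lam q) *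
        ((∏ a ∈ u i, (tx none a + ∑ q ∈ J, tx (some q) a)) * ∏ c ∈ w j, (ty none c + ∑ q ∈ J, ty (some q) c))).det := by
  rw [RingHom.map_det]
  congr 1
  ext i j
  rw [RingHom.mapMatrix_apply, Matrix.map_apply, Matrix.of_apply, Matrix.of_apply]
  exact eval_fullJoinPoly_entry tx ty lam (u i) (w j)

/-- **Two good tables give one common good table.** If the `K`-state full hidden sums of two pairs (on the same `Fin h`) are each
nonsingular at SOME table, they are simultaneously nonsingular at ONE table: the product of the two determinant polynomials is a nonzero
polynomial over `ℂ`, hence has a non-root. -/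
theorem exists_common_table {r₁ r₂ : ℕ} (u₁ w₁ : Fin r₁ → Finset (Fin h)) (u₂ w₂ : Fin r₂ → Finset (Fin h))
    (H₁ : ∃ (tx ty : Option (Fin K) → Fin h → ℂ) (lam : Fin K → ℂ),
      (Matrix.of fun i j : Fin r₁ => ∑ J : Finset (Fin K), (∏ q ∈ J, lam q) *
        ((∏ a ∈ u₁ i, (tx none a + ∑ q ∈ J, tx (some q) a)) * ∏ c ∈ w₁ j, (ty none c + ∑ q ∈ J, ty (some q) c))).det ≠ 0)
    (H₂ : ∃ (tx ty : Option (Fin K) → Fin h → ℂ) (lam : Fin K → ℂ),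
      (Matrix.of fun i j : Fin r₂ => ∑ J : Finset (Fin K), (∏ q ∈ J, lam q) *
        ((∏ a ∈ u₂ i, (tx none a + ∑ q ∈ J, tx (some q) a)) * ∏ c ∈ w₂ j, (ty none c + ∑ q ∈ J, ty (some q) c))).det ≠ 0) :
    ∃ (tx ty : Option (Fin K) → Fin h → ℂ) (lam : Fin K → ℂ),
      (Matrix.of fun i j : Fin r₁ => ∑ J : Finset (Fin K), (∏ q ∈ J, lam q) *
        ((∏ a ∈ u₁ i, (tx none a + ∑ q ∈ J, tx (some q) a)) * ∏ c ∈ w₁ j, (ty none c + ∑ q ∈ J, ty (some q) c))).det ≠ 0 ∧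
      (Matrix.of fun i j : Fin r₂ => ∑ J : Finset (Fin K), (∏ q ∈ J, lam q) *
        ((∏ a ∈ u₂ i, (tx none a + ∑ q ∈ J, tx (some q) a)) * ∏ c ∈ w₂ j, (ty none c + ∑ q ∈ J, ty (some q) c))).det ≠ 0 := by
  classical
  -- the two determinant polynomials
  set P₁ : MvPolynomial ((Option (Fin K) × Fin h) ⊕ (Option (Fin K) × Fin h) ⊕ Fin K) ℂ :=
    (Matrix.of fun i j : Fin r₁ => ∑ J : Finset (Fin K), (∏ q ∈ J, MvPolynomial.X (Sum.inr (Sum.inr q))) *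
        ((∏ a ∈ u₁ i, (MvPolynomial.X (Sum.inl (none, a)) + ∑ q ∈ J, MvPolynomial.X (Sum.inl (some q, a)))) *
          ∏ c ∈ w₁ j, (MvPolynomial.X (Sum.inr (Sum.inl (none, c))) +
            ∑ q ∈ J, MvPolynomial.X (Sum.inr (Sum.inl (some q, c)))))).det with hP₁
  set P₂ : MvPolynomial ((Option (Fin K) × Fin h) ⊕ (Option (Fin K) × Fin h) ⊕ Fin K) ℂ :=
    (Matrix.of fun i j : Fin r₂ => ∑ J : Finset (Fin K), (∏ q ∈ J, MvPolynomial.X (Sum.inr (Sum.inr q))) *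
        ((∏ a ∈ u₂ i, (MvPolynomial.X (Sum.inl (none, a)) + ∑ q ∈ J, MvPolynomial.X (Sum.inl (some q, a)))) *
          ∏ c ∈ w₂ j, (MvPolynomial.X (Sum.inr (Sum.inl (none, c))) +
            ∑ q ∈ J, MvPolynomial.X (Sum.inr (Sum.inl (some q, c)))))).det with hP₂
  have hne₁ : P₁ ≠ 0 := by
    obtain ⟨tx, ty, lam, hdet⟩ := H₁
    intro h0
    apply hdet
    rw [← eval_fullJoinPoly_det u₁ w₁ tx ty lam, ← hP₁, h0, map_zero]
  have hne₂ : P₂ ≠ 0 := by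
    obtain ⟨tx, ty, lam, hdet⟩ := H₂
    intro h0
    apply hdet
    rw [← eval_fullJoinPoly_det u₂ w₂ tx ty lam, ← hP₂, h0, map_zero]
  have hne : P₁ * P₂ ≠ 0 := mul_ne_zero hne₁ hne₂
  -- a nonzero polynomial over `ℂ` has a non-root
  have hex : ∃ v : (Option (Fin K) × Fin h) ⊕ (Option (Fin K) × Fin h) ⊕ Fin K → ℂ, MvPolynomial.eval v (P₁ * P₂) ≠ 0 := by
    by_contra hall
    apply hne
    exact MvPolynomial.funext fun v => by
      rw [map_zero]
      by_contra hv
      exact hall ⟨v, hv⟩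
  obtain ⟨v, hv⟩ := hex
  rw [map_mul] at hv
  refine ⟨fun o a => v (Sum.inl (o, a)), fun o c => v (Sum.inr (Sum.inl (o, c))), fun q => v (Sum.inr (Sum.inr q)), ?_, ?_⟩
  · have h1 := left_ne_zero_of_mul hv
    have e₁ := eval_fullJoinPoly_det u₁ w₁ (fun o a => v (Sum.inl (o, a))) (fun o c => v (Sum.inr (Sum.inl (o, c))))
      (fun q => v (Sum.inr (Sum.inr q)))
    have hv' : (fun x : (Option (Fin K) × Fin h) ⊕ (Option (Fin K) × Fin h) ⊕ Fin K =>
        Sum.elim (fun p => (fun o a => v (Sum.inl (o, a))) p.1 p.2)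
          (Sum.elim (fun p => (fun o c => v (Sum.inr (Sum.inl (o, c)))) p.1 p.2) (fun q => v (Sum.inr (Sum.inr q)))) x) = v := by
      funext x
      rcases x with ⟨o, a⟩ | ⟨o, c⟩ | q <;> rfl
    rw [hv', ← hP₁] at e₁
    rw [← e₁]
    exact h1
  · have h2 := right_ne_zero_of_mul hv
    have e₂ := eval_fullJoinPoly_det u₂ w₂ (fun o a => v (Sum.inl (o, a))) (fun o c => v (Sum.inr (Sum.inl (o, c))))
      (fun q => v (Sum.inr (Sum.inr q)))
    have hv' : (fun x : (Option (Fin K) × Fin h) ⊕ (Option (Fin K) × Fin h) ⊕ Fin K =>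
        Sum.elim (fun p => (fun o a => v (Sum.inl (o, a))) p.1 p.2)
          (Sum.elim (fun p => (fun o c => v (Sum.inr (Sum.inl (o, c)))) p.1 p.2) (fun q => v (Sum.inr (Sum.inr q)))) x) = v := by
      funext x
      rcases x with ⟨o, a⟩ | ⟨o, c⟩ | q <;> rfl
    rw [hv', ← hP₂] at e₂
    rw [← e₂]
    exact h2

variable {r rD rL : ℕ}

/-- **THE EQUAL-LINK STEP from SEPARATE hypotheses.** As `fullJoinCube_step` (p675243), but the deletion pair and the link pair are only
assumed good at SOME table each (`exists_common_table` supplies the common one): FJ(deletion pair, K) ∧ FJ(link pair, K) ⇒ FJ(pair, K + 1)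
for an equal-link split. -/
theorem fullJoinCube_step' (u w : Fin r → Finset (Fin h)) (a b : Fin h)
    (eRow eCol : Fin rD ⊕ Fin rL ≃ Fin r)
    (hDrow : ∀ i, a ∉ u (eRow (Sum.inl i))) (hLrow : ∀ ℓ, a ∈ u (eRow (Sum.inr ℓ)))
    (hDcol : ∀ j, b ∉ w (eCol (Sum.inl j))) (hLcol : ∀ ℓ, b ∈ w (eCol (Sum.inr ℓ)))
    (π : Fin rL → Fin rD) (hπ : ∀ ℓ, u (eRow (Sum.inl (π ℓ))) = (u (eRow (Sum.inr ℓ))).erase a)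
    (HD : ∃ (tx ty : Option (Fin K) → Fin h → ℂ) (lam : Fin K → ℂ),
      (Matrix.of fun i j : Fin rD => ∑ J : Finset (Fin K), (∏ q ∈ J, lam q) *
          ((∏ a' ∈ u (eRow (Sum.inl i)), (tx none a' + ∑ q ∈ J, tx (some q) a')) *
            ∏ c ∈ w (eCol (Sum.inl j)), (ty none c + ∑ q ∈ J, ty (some q) c))).det ≠ 0)
    (HL : ∃ (tx ty : Option (Fin K) → Fin h → ℂ) (lam : Fin K → ℂ),
      (Matrix.of fun ℓ ℓ' : Fin rL => ∑ J : Finset (Fin K), (∏ q ∈ J, lam q) *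
          ((∏ a' ∈ (u (eRow (Sum.inr ℓ))).erase a, (tx none a' + ∑ q ∈ J, tx (some q) a')) *
            ∏ c ∈ (w (eCol (Sum.inr ℓ'))).erase b, (ty none c + ∑ q ∈ J, ty (some q) c))).det ≠ 0) :
    ∃ (tx' ty' : Option (Fin (K + 1)) → Fin h → ℂ) (lam' : Fin (K + 1) → ℂ),
      (Matrix.of fun i j : Fin r => ∑ J : Finset (Fin (K + 1)), (∏ q ∈ J, lam' q) *
        ((∏ a' ∈ u i, (tx' none a' + ∑ q ∈ J, tx' (some q) a')) *
          ∏ c ∈ w j, (ty' none c + ∑ q ∈ J, ty' (some q) c))).det ≠ 0 := by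
  obtain ⟨tx, ty, lam, hD, hL⟩ := exists_common_table (fun i => u (eRow (Sum.inl i))) (fun j => w (eCol (Sum.inl j)))
    (fun ℓ => (u (eRow (Sum.inr ℓ))).erase a) (fun ℓ' => (w (eCol (Sum.inr ℓ'))).erase b) HD HL
  exact fullJoinCube_step u w a b eRow eCol hDrow hLrow hDcol hLcol π hπ ⟨tx, ty, lam, hD, hL⟩

end FullJoin

end

end Summit.ValiantsHypothesis.ValiantsHypothesis.Theorems.BarrierLever.HiddenStates
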